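import Summits.CriticalPhenomena.PercolationContinuityZ3.Theorems.PercNearOneGluingNoHeavyQuantSDECLight
import Summits.CriticalPhenomena.PercolationContinuityZ3.Theorems.PercNearOneGluingNoHeavyQuantSiblingStep
import Summits.CriticalPhenomena.PercolationContinuityZ3.Theorems.PercNearOneGluingNoHeavyQuantFarTreeRowLightHalf
import HarnessLib

/-!
# QUANT lane R8, T-DEC: THE LIGHT STRUCTURAL INDUCTION — `LightSiblingStep` (the sibling step with the LIGHT oracle and the LIGHT conclusion
# `SDECLight`) ⟹ every tree-built law is `SDECLight` ⟹ `TreeBuiltFARLight` ⟹ `Quant.FarTreeRow`, UNCONDITIONALLY; and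
# `SiblingStep ⟹ LightSiblingStep` (arm-1 gen 50, architect)

builds on p205010 (kernel theorem, internal audit signed; external expert review pending)

Statement + support file (`--supports stmt-CriticalPhenomena-4575`), QUANT lane seat prim-quant-arm-1 (gen 50, architect), rung R8 of
`run/shared/lean/prim/quant/LADDER.md`; memo `run/shared/lean/prim/quant/prim-quant-arm-1-g50/ARCH-G50.md`.  One `@[conjecture]`
(`LightSiblingStep`); theorems with standard axioms, no sorries.  Sequel of `…QuantSDECLight` (the invariant `SDECLight`, its gate / floor / slice /
two-root closure); mirrors typer g39's `…QuantSiblingStep` skeleton (`CompForestN`, `BlobForest`, `TreeBuiltN.partition`,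
`sdec_compForestN_of_siblingStep`, `sdec_lconv_blobForest`, `sdec_of_treeBuiltN_of_siblingStep`) with `SDEC` replaced by `SDECLight`
throughout, and lands on typer g38's `TreeBuiltFARLight` / `farTreeRow_of_treeBuiltFARLight` (the heavy half is the theorem
`farTreeRowHeavy_holds`, arm-3 g168).

THE POINT (ARCH-G50 §1).  The structural induction needs, at every node, only DEC statements at floors `≤ 1/2`: (i) the row of a LIGHT forest
(`x < 1/2`) is DEC at floor `x` at dominant layers; (ii) the product part of a gate step at outer gate `a` needs the gated sub-forests DEC at the
gated floor `min(a·x, 1/2)` — supplied by `SDECLight` of the sub-forests whatever their own (possibly heavy) floors; (iii) blob siblings and the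
width-2 case go through unchanged (`sdecLight_slice`, `sdecLight_twoRoot_of_opened`).  Hence the sibling step may be weakened on BOTH sides — light
oracle, light conclusion — and still give `FarTreeRow`:
* **`@[conjecture] LightSiblingStep`**: for a forest of `k ≥ 3` composite sibling trees (`CompForestN x n M μ k`), IF every tree-built law with
  fewer than `n` nontrivial gates is `SDECLight` at its floor THEN `SDECLight x M μ`.  `SiblingStep ⟹ LightSiblingStep`
  (`lightSiblingStep_of_siblingStep`, via `GateStepN` and `sdec_of_treeBuiltN`); the two are not obviously equivalent (weaker oracle).
* `sdecLight_opened_of_oracle`, `lightGateStep_of_tree` (width 2, light), `sdecLight_compForestN_of_lightSiblingStep` (width 0 / 1 / 2 / ≥ 3),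
  `sdecLight_lconv_blobForest` (blob siblings by `sdecLight_lconv_gate_point`), **`sdecLight_of_treeBuiltN_of_lightSiblingStep`** (strong
  induction on the gate count), **`treeBuiltFARLight_of_lightSiblingStep`**, **`Quant.farTreeRow_of_lightSiblingStep : LightSiblingStep → FarTreeRow`**.
The light node of record `LightResidDEC` (the top-level residual DEC at the CAPPED floor) and `LightResidDEC ⟸ ResidDEC`, `⟹ LightSiblingStep`
are the sequel `…QuantLightResidDEC`.

HONEST STATUS: `LightSiblingStep`, `SiblingStep`, `GateStepN`, `FarTreeRow` OPEN; this file is an unconditional REDUCTION (the light induction),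
not a proof of the node.  EVIDENCE for the light node: every instance of the node of record is one (`ResidDEC ⟹ LightResidDEC`); at the capped
floor the four closed-form criteria (no-low / half-top / low-ceiling / budget) certify 100 % of ≈ 40 000 exact (forest, outer-gate) pairs incl.
1 332 heavy random forests (ARCH-G50 §2), against 1 419 exceptions at the natural floor.  RATE class log\* / honest sentence of
`run/shared/lean/prim/quant/README.md` unchanged.  [this work]; skeleton: prim-quant-stmt g39 / lead g42; light half: typer g35/g38, arm-3 g168.
Nothing here is cited as a published result.  The gluing rows served [cite: KozmaNitzan2024, Conjecture 3 (p. 15)]; product measure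
[cite: Grimmett1999, §1.3 p. 10].
-/

noncomputable section

namespace Summit.CriticalPhenomena.PercolationContinuityZ3.Theorems

namespace Quant

open Finset

namespace LawDec

/-! ### The light node -/

/-- **CONJECTURE (THE LIGHT SIBLING STEP; arm-1 g50 ARCH-G50 §1).**  For a forest of `k ≥ 3` COMPOSITE sibling trees at floor `x`
(`CompForestN x n M μ k`): IF every tree-built law with FEWER than `n` nontrivial gates is `SDECLight` at its floor (every gating DEC at the
CAPPED floor `min(q·x′, 1/2)` — the light induction hypothesis), THEN `μ` is `SDECLight` at `x`.  Implied by `SiblingStep`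
(`lightSiblingStep_of_siblingStep`); implies `Quant.FarTreeRow` unconditionally (`farTreeRow_of_lightSiblingStep`); implied by the light node of
record `LightResidDEC` (`…QuantLightResidDEC`).  Differs from `SiblingStep` exactly by dropping every DEC obligation at a gated floor above `1/2`
(sub-forests at heavy floors), none of which is used on the way to the far row.  EVIDENCE: that of `ResidDEC` (census-1 g24: 0 / ≈ 3·10⁵) plus
ARCH-G50 §2 (at the capped floor the closed-form criteria have no exception on ≈ 40 000 exact pairs incl. heavy forests).
builds on p205010 (kernel theorem, internal audit signed; external expert review pending). [this work] [status: open] -/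
@[conjecture] def LightSiblingStep : Prop :=
  ∀ (x : ℝ) (n M k : ℕ) (μ : ℕ → ℝ), 3 ≤ k → CompForestN x n M μ k →
    (∀ (x' : ℝ) (n' M' : ℕ) (μ' : ℕ → ℝ), n' < n → TreeBuiltN x' n' M' μ' → SDECLight x' M' μ') →
    SDECLight x M μ

/-- `GateStepN ⟹ LightSiblingStep` (under `GateStepN` every tree-built law is SDEC, hence `SDECLight`). [this work] -/
theorem lightSiblingStep_of_gateStepN (hG : GateStepN) : LightSiblingStep :=
  fun _ _ _ _ _ _ hF _ => sdecLight_of_sdec (sdec_of_treeBuiltN hG hF.treeBuiltN) hF.floor.2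

/-- **`SiblingStep ⟹ LightSiblingStep`**: the light node is implied by the node of the lane. [this work] -/
theorem lightSiblingStep_of_siblingStep (hS : SiblingStep) : LightSiblingStep :=
  lightSiblingStep_of_gateStepN (gateStepN_of_siblingStep' hS)

/-! ### Width two under the light oracle -/

/-- the opened two-tree forest is a light-oracle instance: `ρ_a ∗ gate_r ρ_b` at floor `w` with `n_a + n_b (+1)` gates is `SDECLight` when
`n_a + n_b + 1 < n` (`r = 1` without a gate). [this work] -/
theorem sdecLight_opened_of_oracle (n : ℕ) (w r : ℝ) (na nb Ma Mb : ℕ) (ρa ρb : ℕ → ℝ)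
    (hO : ∀ (x' : ℝ) (n' M' : ℕ) (μ' : ℕ → ℝ), n' < n → TreeBuiltN x' n' M' μ' → SDECLight x' M' μ')
    (hn : na + nb + 1 < n) (hw0 : 0 < w) (hr0 : 0 < r) (hr1 : r ≤ 1)
    (ha : TreeBuiltN w na Ma ρa) (hb : TreeBuiltN (w / r) nb Mb ρb) :
    SDECLight w (Ma + Mb) (lconv Ma Mb ρa (gate ρb r)) := by
  rcases eq_or_lt_of_le hr1 with hr | hr
  · subst hr
    rw [gate_one]
    rw [div_one] at hb
    exact hO w (na + nb) (Ma + Mb) _ (by omega) (TreeBuiltN.conv ha hb)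
  · have hgb : TreeBuiltN (r * (w / r)) (nb + 1) Mb (gate ρb r) := TreeBuiltN.gate r hr0 hr hb
    have e : r * (w / r) = w := by field_simp
    rw [e] at hgb
    exact hO w (na + (nb + 1)) (Ma + Mb) _ (by omega) (TreeBuiltN.conv ha hgb)

/-- **THE TWO-TREE FOREST UNDER THE LIGHT ORACLE** (= `gateStepN_of_tree` with `SDECLight`): `gate_{q₁} ρ₁ ∗ gate_g c` is `SDECLight` at `x`
when `ρ₁` (at `x₁`, `x ≤ q₁x₁`), `c` (at `x/g`) are tree-built with `n₁′ + n₂ + 2 ≤ n` gates and the light oracle holds below `n`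
(arm-1 g45's two-root identity: open the heavier root). [this work] -/
theorem lightGateStep_of_tree (n : ℕ) (x g q₁ x₁ : ℝ) (n₁' n₂ M₁ M₂ : ℕ) (ρ₁ c : ℕ → ℝ)
    (hO : ∀ (x' : ℝ) (n' M' : ℕ) (μ' : ℕ → ℝ), n' < n → TreeBuiltN x' n' M' μ' → SDECLight x' M' μ')
    (hn : n₁' + n₂ + 2 ≤ n) (hx0 : 0 < x) (hxg : x < g) (hg1 : g < 1) (hq0 : 0 < q₁) (hq1 : q₁ < 1) (hxq : x ≤ q₁ * x₁)
    (hρ : TreeBuiltN x₁ n₁' M₁ ρ₁) (hc : TreeBuiltN (x / g) n₂ M₂ c) :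
    SDECLight x (M₁ + M₂) (lconv M₁ M₂ (gate ρ₁ q₁) (gate c g)) := by
  have hg0 : 0 < g := lt_trans hx0 hxg
  obtain ⟨hx₁0, hx₁1, r0, rM, r1, rta⟩ := hρ.lawFacts
  obtain ⟨hy0, hy1, c0, cM, c1, cta⟩ := hc.lawFacts
  have hSρ : SDECLight x₁ M₁ ρ₁ := hO x₁ n₁' M₁ ρ₁ (by omega) hρ
  have hSc : SDECLight (x / g) M₂ c := hO (x / g) n₂ M₂ c (by omega) hc
  have hxg' : x ≤ g * (x / g) := by rw [mul_div_cancel₀ x hg0.ne']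
  rcases le_or_gt g q₁ with hgq | hqg
  · -- heavy root `q₁`: open `ρ₁`, re-gate `c` to `g/q₁`; opened forest at floor `x/q₁`
    have hw0 : 0 < x / q₁ := div_pos hx0 hq0
    have hρ' : TreeBuiltN (x / q₁) n₁' M₁ ρ₁ :=
      TreeBuiltN.mono hρ hw0 (by rw [div_le_iff₀ hq0]; linarith [mul_comm q₁ x₁])
    have hr0 : 0 < g / q₁ := div_pos hg0 hq0
    have hr1 : g / q₁ ≤ 1 := by rw [div_le_one hq0]; exact hgq
    have e : x / q₁ / (g / q₁) = x / g := by field_simp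
    have hc' : TreeBuiltN (x / q₁ / (g / q₁)) n₂ M₂ c := by rw [e]; exact hc
    have hG : SDECLight (x / q₁) (M₁ + M₂) (lconv M₁ M₂ ρ₁ (gate c (g / q₁))) :=
      sdecLight_opened_of_oracle n (x / q₁) (g / q₁) n₁' n₂ M₁ M₂ ρ₁ c hO (by omega) hw0 hr0 hr1 hρ' hc'
    exact sdecLight_twoRoot_of_opened x₁ (x / g) (x / q₁) x q₁ g M₁ M₂ ρ₁ c hx₁0 hx₁1 hy0 hy1 hg0 hgq hq1 hx0
      r0 rM r1 rta c0 cM c1 cta hSρ hSc hG hxq hxg' (by rw [mul_div_cancel₀ x hq0.ne'])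
  · -- heavy root `g`: swap the factors, open `c`, re-gate `ρ₁` to `q₁/g`; opened forest at floor `x/g`
    rw [lconv_comm, Nat.add_comm]
    have hr0 : 0 < q₁ / g := div_pos hq0 hg0
    have hr1 : q₁ / g ≤ 1 := by rw [div_le_one hg0]; exact hqg.le
    have e : x / g / (q₁ / g) = x / q₁ := by field_simp
    have hρ' : TreeBuiltN (x / g / (q₁ / g)) n₁' M₁ ρ₁ := by
      rw [e]
      exact TreeBuiltN.mono hρ (div_pos hx0 hq0) (by rw [div_le_iff₀ hq0]; linarith [mul_comm q₁ x₁])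
    have hG : SDECLight (x / g) (M₂ + M₁) (lconv M₂ M₁ c (gate ρ₁ (q₁ / g))) :=
      sdecLight_opened_of_oracle n (x / g) (q₁ / g) n₂ n₁' M₂ M₁ c ρ₁ hO (by omega) hy0 hr0 hr1 hc hρ'
    exact sdecLight_twoRoot_of_opened (x / g) x₁ (x / g) x g q₁ M₂ M₁ c ρ₁ hy0 hy1 hx₁0 hx₁1 hq0 hqg.le hg1 hx0
      c0 cM c1 cta r0 rM r1 rta hSc hSρ hG hxg' hxq hxg'

/-! ### The light structural induction -/

/-- **A COMPOSITE FOREST IS `SDECLight` under the light oracle below a budget `N ≥` its gate count** — width `0`: nothing; width `1`: the oracle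
on the sub-forest and `sdecLight_gate` / `sdecLight_mono`; width `2`: `lightGateStep_of_tree`; width `≥ 3`: THE LIGHT NODE. [this work] -/
theorem sdecLight_compForestN_of_lightSiblingStep (hS : LightSiblingStep) (N : ℕ)
    (hO : ∀ (x' : ℝ) (n' M' : ℕ) (μ' : ℕ → ℝ), n' < N → TreeBuiltN x' n' M' μ' → SDECLight x' M' μ')
    {x : ℝ} {n M k : ℕ} {μ : ℕ → ℝ} (hF : CompForestN x n M μ k) (hn : n ≤ N) : SDECLight x M μ := by
  have hF0 := hF
  cases hF with
  | nil _ _ =>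
    intro q _ _ j' hj; omega
  | @tree n₀ M₀ k₀ μ₀ hF₁ x₁ n₁ M₁ ρ₁ q₁ hq₁0 hq₁1 hxq₁ hρ₁ _ =>
    obtain ⟨_, _, _, hg₁M, _, _⟩ := (TreeBuiltN.gate q₁ hq₁0 hq₁1 hρ₁).lawFacts
    cases hF₁ with
    | nil hx0 _ =>
      -- width 1: `δ₀ ∗ gate ρ₁ q₁ = gate ρ₁ q₁`
      have e : lconv 0 M₁ (fun h => if h = 0 then (1 : ℝ) else 0) (gate ρ₁ q₁) = gate ρ₁ q₁ :=
        funext fun h => lconv_delta_left 0 M₁ _ hg₁M h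
      rw [e, Nat.zero_add]
      have hSρ : SDECLight x₁ M₁ ρ₁ := hO x₁ n₁ M₁ ρ₁ (by omega) hρ₁
      exact sdecLight_mono (sdecLight_gate hSρ q₁ hq₁0 hq₁1.le) hxq₁
    | @tree n₀' M₀' k₀' μ₀' hF₂ x₂ n₂ M₂ ρ₂ q₂ hq₂0 hq₂1 hxq₂ hρ₂ _ =>
      obtain ⟨_, _, _, hg₂M, _, _⟩ := (TreeBuiltN.gate q₂ hq₂0 hq₂1 hρ₂).lawFacts
      cases hF₂ with
      | nil hx0 _ =>
        -- width 2: the two-root identity fed by the light oracle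
        have e : lconv 0 M₂ (fun h => if h = 0 then (1 : ℝ) else 0) (gate ρ₂ q₂) = gate ρ₂ q₂ :=
          funext fun h => lconv_delta_left 0 M₂ _ hg₂M h
        rw [e, Nat.zero_add]
        obtain ⟨_, hx₁1, _, _, _, _⟩ := hρ₁.lawFacts
        have hxg : x < q₁ := lt_of_le_of_lt hxq₁ (by nlinarith)
        have hc : TreeBuiltN (x / q₁) n₁ M₁ ρ₁ :=
          TreeBuiltN.mono hρ₁ (div_pos hx0 hq₁0) (by rw [div_le_iff₀ hq₁0]; linarith [mul_comm q₁ x₁])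
        exact lightGateStep_of_tree N x q₁ q₂ x₂ n₂ n₁ M₂ M₁ ρ₂ ρ₁ hO (by omega) hx0 hxg hq₁1 hq₂0 hq₂1 hxq₂ hρ₂ hc
      | tree _ _ _ _ _ _ _ =>
        -- width ≥ 3: THE LIGHT NODE, with the forest's own gate count as budget
        exact hS x _ _ _ _ (by omega) hF0 (fun x' n' M' μ' hlt h' => hO x' n' M' μ' (by omega) h')

/-- **A BLOB FOREST beside an `SDECLight` tree-built law is absorbed** (`sdecLight_lconv_gate_point` once per blob, CW fed in; `K = 0` blobs are
nothing). [this work] -/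
theorem sdecLight_lconv_blobForest {x : ℝ} {n M : ℕ} {μ : ℕ → ℝ} (hT : TreeBuiltN x n M μ) (hS : SDECLight x M μ)
    {MB : ℕ} {μB : ℕ → ℝ} (hB : BlobForest x MB μB) : SDECLight x (M + MB) (lconv M MB μ μB) := by
  induction hB with
  | nil hx0 hx1 =>
    obtain ⟨_, _, _, hμM, _, _⟩ := hT.lawFacts
    have e : lconv M 0 μ (fun h => if h = 0 then (1 : ℝ) else 0) = μ := funext fun h => lconv_delta_right M 0 μ hμM h
    rw [e]; exact hS
  | @blob M' μ' hB' x₁ n₁ K q hq0 hq1 hxq hρ ih =>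
    obtain ⟨nB, hTB⟩ := hB'.exists_treeBuiltN
    obtain ⟨hx0, _, h0, hM2, h1, hta⟩ := (TreeBuiltN.conv hT hTB).lawFacts
    obtain ⟨_, hx₁1, _, _, _, _⟩ := hρ.lawFacts
    have hS2 : SDECLight x (M + M') (lconv M M' μ μ') := ih
    have hxq' : x ≤ q := le_trans hxq (by nlinarith)
    rw [show M + (M' + K) = M + M' + K from (Nat.add_assoc _ _ _).symm, lconv_assoc,
      lconv_gate_point_eq_slice (M + M') K _ q hM2]
    rcases Nat.eq_zero_or_pos K with hK | hK
    · subst hK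
      have e : slice (lconv M M' μ μ') 0 q = lconv M M' μ μ' := by
        funext h; simp only [slice, Nat.zero_le, if_true, Nat.sub_zero]; ring
      rw [e]; exact hS2
    · exact sdecLight_slice x q (M + M') K _ hx0 hxq' hq1 hK h0 hM2 h1 hta hS2

/-- **EVERY TREE-BUILT LAW IS `SDECLight` under `LightSiblingStep`** (strong induction on the gate count; forest normal form, the composite
part by width, the blob part by slicing — CW is a theorem of the tree). [this work] -/
theorem sdecLight_of_treeBuiltN_of_lightSiblingStep (hS : LightSiblingStep) {x : ℝ} {n M : ℕ} {μ : ℕ → ℝ}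
    (h : TreeBuiltN x n M μ) : SDECLight x M μ := by
  have key : ∀ m : ℕ, ∀ (x' : ℝ) (n' M' : ℕ) (μ' : ℕ → ℝ), n' ≤ m → TreeBuiltN x' n' M' μ' → SDECLight x' M' μ' := by
    intro m
    induction m using Nat.strong_induction_on with
    | _ m ihm =>
      intro x' n' M' μ' hle h'
      have hO : ∀ (x'' : ℝ) (n'' M'' : ℕ) (μ'' : ℕ → ℝ), n'' < m → TreeBuiltN x'' n'' M'' μ'' → SDECLight x'' M'' μ'' :=
        fun x'' n'' M'' μ'' hlt h'' => ihm n'' hlt x'' n'' M'' μ'' le_rfl h''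
      obtain ⟨k, nC, MC, MB, μC, μB, hC, hB, hnC, hM, hμ⟩ := h'.partition
      subst hM; subst hμ
      exact sdecLight_lconv_blobForest hC.treeBuiltN (sdecLight_compForestN_of_lightSiblingStep hS m hO hC (by omega)) hB
  exact key n x n M μ le_rfl h

/-- **`LightSiblingStep ⟹ TreeBuiltFARLight`**: a tree-built law at a LIGHT floor `x < 1/2` is `SDECLight`, hence DEC at floor `x` itself at
every layer below the top (`decAt_of_sdecLight`; Theorem A above the top), hence the far row at dominant layers (`tail_ge_of_decAt`). [this work] -/
theorem treeBuiltFARLight_of_lightSiblingStep (hS : LightSiblingStep) : TreeBuiltFARLight := by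
  intro x M μ hT hx j hdom
  obtain ⟨n, hN⟩ := hT.exists_treeBuiltN
  obtain ⟨hx0, hx1, h0, hM, h1, hta⟩ := hN.lawFacts
  have hL := sdecLight_of_treeBuiltN_of_lightSiblingStep hS hN
  have hdec : DECAt x j M μ := by
    by_cases hj : j < M
    · exact decAt_of_sdecLight hL hx.le j hj
    · refine decAt_of_top_le M μ h0 hM h1 x hx1 (fun h hh => ?_) j (not_lt.1 hj)
      have hhM : h ≤ M := by
        by_contra hlt; exact absurd (hM h (not_le.1 hlt)) (ne_of_gt hh)
      have : x * (h : ℝ) ≤ x * (M : ℝ) := mul_le_mul_of_nonneg_left (by exact_mod_cast hhM) hx0.le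
      linarith
  exact tail_ge_of_decAt x j M μ hx1.le hdec hdom

end LawDec

/-- **`LightSiblingStep ⟹ Quant.FarTreeRow`, UNCONDITIONALLY** — the R8 tree row from the LIGHT sibling step alone (light oracle, light
conclusion): typer g38's `farTreeRow_of_treeBuiltFARLight` (heavy half = `farTreeRowHeavy_holds`). [this work] -/
theorem farTreeRow_of_lightSiblingStep (hS : LawDec.LightSiblingStep) : FarTreeRow :=
  farTreeRow_of_treeBuiltFARLight (LawDec.treeBuiltFARLight_of_lightSiblingStep hS)

end Quant

end Summit.CriticalPhenomena.PercolationContinuityZ3.Theorems
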